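import Mathlib
import HarnessLib
import Summits.Ventures.LatticeQCDFlow.Exactness.QuasiStaticSecondOrder
import Summits.Ventures.LatticeQCDFlow.Exactness.QuasiStaticPathKL

/-!
# The floor law under perfect relaxation: `D̃_KL`, its reverse twin, a certified ESS ceiling

HONEST FRAMING: exact (Metropolis-corrected) sampling algorithms for lattice gauge theory;
figures of merit are autocorrelation/cost numbers at stated couplings and volumes; no
continuum-physics claim.

Venture `LatticeQCDFlow` (cell pub-lqcd), topic `Exactness`, FANOUT row 8 (s0-cpn-nemc, GEN-4).
OUR WORK (elementary), nothing cited as a fact.  Assembles `QuasiStaticSecondOrder.lean` (the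
trapezoid law `|KL_qs(n) − (⟨D⟩_0 − ⟨D⟩_1)/(2n)| ≤ M/(12n²)`) with `QuasiStaticPathKL.lean`
(`D(P_F ‖ P_R) = KL_qs` under perfect relaxation) and the theory seat's T2-W′
`Theory2.ess_perfect_relaxation_le` (`ÊSS ≤ exp(−Σ_k D(π_{k+1} ‖ π_k))`), for the uniform
linear protocol `c_k = k/n` of Bonanno–Nada–Vadacchino 2024 with every layer resampling exactly
from its Gibbs law:

* `sum_klFin_add_klFin_symm` — Jeffreys along any grid: `Σ_k [D(π_{c_k} ‖ π_{c_{k+1}}) +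
  D(π_{c_{k+1}} ‖ π_{c_k})] = Σ_k (c_{k+1} − c_k)(⟨D⟩_{c_k} − ⟨D⟩_{c_{k+1}})`;
* `sum_klFin_reverse_uniform_eq` — the REVERSE stepwise sum is `(⟨D⟩_0 − ⟨D⟩_1)/n − KL_qs(n)`,
  hence (`abs_sum_klFin_reverse_uniform_sub_floor_le`) it, too, is the floor up to `M/(12n²)`
  (with the opposite sign of the defect);
* **`abs_kl_path_perfect_uniform_sub_floor_le`** —
  `|D(P_F ‖ P_R) − (⟨D⟩_0 − ⟨D⟩_1)/(2n)| ≤ M/(12n²)`: the printed `D̃_KL = ⟨W⟩ − ΔF` of the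
  perfectly relaxed protocol IS the floor to second order;
* **`ess_perfect_uniform_le_exp`** — `ÊSS ≤ exp(−(⟨D⟩_0 − ⟨D⟩_1)/(2n) + M/(12n²))`: a
  CERTIFIED effective-sample-size ceiling for the perfectly relaxed protocol.

Numbers (OURS, HOME/s0-cpn-nemc/RESULTS.md §7(c)/§9; not proved here): at (N, β, L, L_d, n_step)
= (21, 0.7, 114, 24, 1000) the floor is 0.2965 and `M/(12n²) ≤ 8.3·10⁻⁴` for the envelope
`M = 10⁴` of the measured skewness scale, so under perfect relaxation `D̃_KL ∈ [0.2957, 0.2973]`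
and `ÊSS ≤ e^{−0.2957} = 0.744`.  This rigorous ceiling is WEAKER than the Gaussian-work ceiling
`e^{−2·KL_qs} = 0.553` of RESULTS §7(c)(ii) (which rests on the measured Gaussianity of `W`,
theirs and ours, not on a theorem): the printed Table-3 value 0.731(6) violates the latter, not
the former — recorded so that the typed bound and the empirical law stay distinguishable.
-/

namespace Summit.Ventures.LatticeQCDFlow.Exactness

open Finset Set
open Summit.Ventures.LatticeQCDFlow.Theory2

variable {X : Type*} [Fintype X]

/-- **Jeffreys along a grid.**  The symmetrised stepwise relative entropies of the linear family
sum to `Σ_k (c_{k+1} − c_k)(⟨D⟩_{c_k} − ⟨D⟩_{c_{k+1}})` (free energies cancel). -/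
theorem sum_klFin_add_klFin_symm [Nonempty X] (S₀ D : X → ℝ) (c : ℕ → ℝ) (n : ℕ) :
    ∑ k ∈ range n,
        (klFin (gibbsLaw (linAction S₀ D (c k))) (gibbsLaw (linAction S₀ D (c (k + 1))))
          + klFin (gibbsLaw (linAction S₀ D (c (k + 1)))) (gibbsLaw (linAction S₀ D (c k))))
      = ∑ k ∈ range n, (c (k + 1) - c k) * (meanD S₀ D (c k) - meanD S₀ D (c (k + 1))) := by
  refine sum_congr rfl (fun k _ => ?_)
  rw [klFin_gibbsLaw_linAction, klFin_gibbsLaw_linAction]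
  ring

/-- **The reverse stepwise sum of the uniform protocol** (the exponent of T2-W′):
`Σ_{k<n} D(π_{(k+1)/n} ‖ π_{k/n}) = (⟨D⟩_0 − ⟨D⟩_1)/n − KL_qs(n)`. -/
theorem sum_klFin_reverse_uniform_eq [Nonempty X] (S₀ D : X → ℝ) {n : ℕ} (hn : n ≠ 0) :
    ∑ k ∈ range n, klFin (gibbsLaw (linAction S₀ D (((k + 1 : ℕ) : ℝ) / n)))
        (gibbsLaw (linAction S₀ D ((k : ℝ) / n)))
      = (meanD S₀ D 0 - meanD S₀ D 1) / n - qsDissipation S₀ D (fun k => (k : ℝ) / n) n := by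
  have hn' : (n : ℝ) ≠ 0 := Nat.cast_ne_zero.mpr hn
  have hsymm := sum_klFin_add_klFin_symm S₀ D (fun k => (k : ℝ) / n) n
  rw [sum_add_distrib, ← qsDissipation_eq_sum_klFin] at hsymm
  have htel : ∑ k ∈ range n, ((((k + 1 : ℕ) : ℝ) / n - (k : ℝ) / n)
      * (meanD S₀ D ((k : ℝ) / n) - meanD S₀ D (((k + 1 : ℕ) : ℝ) / n)))
      = (meanD S₀ D 0 - meanD S₀ D 1) / n := by
    have hstep : ∀ k ∈ range n, (((k + 1 : ℕ) : ℝ) / n - (k : ℝ) / n)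
        * (meanD S₀ D ((k : ℝ) / n) - meanD S₀ D (((k + 1 : ℕ) : ℝ) / n))
        = 1 / (n : ℝ) * (meanD S₀ D ((k : ℝ) / n) - meanD S₀ D (((k + 1 : ℕ) : ℝ) / n)) := by
      intro k _
      rw [succ_div_sub_div hn]
    rw [sum_congr rfl hstep, ← mul_sum, sum_range_sub' (fun k => meanD S₀ D ((k : ℝ) / n)) n]
    simp only [Nat.cast_zero, zero_div, div_self hn']
    ring
  rw [htel] at hsymm
  linarith

/-- **The reverse sum is the floor to second order** (defect with the opposite sign):
`|Σ_{k<n} D(π_{(k+1)/n} ‖ π_{k/n}) − (⟨D⟩_0 − ⟨D⟩_1)/(2n)| ≤ M/(12n²)`. -/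
theorem abs_sum_klFin_reverse_uniform_sub_floor_le [Nonempty X] (S₀ D : X → ℝ) {n : ℕ}
    (hn : n ≠ 0) {M : ℝ} (hM : ∀ c ∈ Icc (0:ℝ) 1, |kappa3D S₀ D c| ≤ M) :
    |∑ k ∈ range n, klFin (gibbsLaw (linAction S₀ D (((k + 1 : ℕ) : ℝ) / n)))
          (gibbsLaw (linAction S₀ D ((k : ℝ) / n)))
        - (meanD S₀ D 0 - meanD S₀ D 1) / (2 * n)| ≤ M / (12 * (n : ℝ) ^ 2) := by
  have h := abs_qsDissipation_uniform_sub_floor_le S₀ D hn hM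
  rw [sum_klFin_reverse_uniform_eq S₀ D hn]
  rw [abs_le] at h ⊢
  constructor
  · have : (meanD S₀ D 0 - meanD S₀ D 1) / ↑n = 2 * ((meanD S₀ D 0 - meanD S₀ D 1) / (2 * ↑n)) := by
      field_simp
    linarith [h.2]
  · have : (meanD S₀ D 0 - meanD S₀ D 1) / ↑n = 2 * ((meanD S₀ D 0 - meanD S₀ D 1) / (2 * ↑n)) := by
      field_simp
    linarith [h.1]

/-- **`D̃_KL` of the perfectly relaxed uniform protocol is the floor to second order**:
`|D(P_F ‖ P_R) − (⟨D⟩_0 − ⟨D⟩_1)/(2n)| ≤ M/(12n²)` when `|κ₃,c(D)| ≤ M` on `[0, 1]`. -/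
theorem abs_kl_path_perfect_uniform_sub_floor_le [Nonempty X] (S₀ D : X → ℝ) {n : ℕ} (hn : n ≠ 0)
    {M : ℝ} (hM : ∀ c ∈ Icc (0:ℝ) 1, |kappa3D S₀ D c| ≤ M) :
    |klFin (pathLaw (gibbsLaw (linAction S₀ D ((0 : ℕ) / (n : ℝ))))
            (fun (k : Fin n) (_ : X) (y : X) =>
              gibbsLaw (linAction S₀ D (((k + 1 : ℕ) : ℝ) / n)) y))
        (revPathLaw (fun k : Fin (n + 1) => linAction S₀ D ((k : ℕ) / (n : ℝ)))
            (fun k _ y => gibbsLaw (linAction S₀ D (((k + 1 : ℕ) : ℝ) / n)) y))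
      - (meanD S₀ D 0 - meanD S₀ D 1) / (2 * n)| ≤ M / (12 * (n : ℝ) ^ 2) := by
  have h := kl_path_perfect_eq_qsDissipation S₀ D (fun k => (k : ℝ) / n) n
  simp only [] at h
  rw [h]
  exact abs_qsDissipation_uniform_sub_floor_le S₀ D hn hM

/-- **Certified ESS ceiling for the perfectly relaxed uniform protocol**:
`ÊSS ≤ exp(−(⟨D⟩_0 − ⟨D⟩_1)/(2n) + M/(12n²))` (T2-W′ with the reverse sum evaluated to second
order). -/
theorem ess_perfect_uniform_le_exp [Nonempty X] [DecidableEq X] (S₀ D : X → ℝ) {n : ℕ}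
    (hn : n ≠ 0) {M : ℝ} (hM : ∀ c ∈ Icc (0:ℝ) 1, |kappa3D S₀ D c| ≤ M) :
    essFrac (revPathLaw (fun k : Fin (n + 1) => linAction S₀ D ((k : ℕ) / (n : ℝ)))
              (fun k _ y => gibbsLaw (linAction S₀ D (((k + 1 : ℕ) : ℝ) / n)) y))
            (pathLaw (gibbsLaw (linAction S₀ D ((0 : ℕ) / (n : ℝ))))
              (fun (k : Fin n) (_ : X) (y : X) =>
                gibbsLaw (linAction S₀ D (((k + 1 : ℕ) : ℝ) / n)) y))
      ≤ Real.exp (-((meanD S₀ D 0 - meanD S₀ D 1) / (2 * n)) + M / (12 * (n : ℝ) ^ 2)) := by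
  have h := ess_perfect_relaxation_le (fun k : Fin (n + 1) => linAction S₀ D ((k : ℕ) / (n : ℝ)))
  simp only [Fin.val_succ, Fin.val_castSucc, Fin.val_zero] at h
  have hsum : ∑ k : Fin n, klFin (gibbsLaw (linAction S₀ D (((k : ℕ) + 1 : ℕ) / (n : ℝ))))
        (gibbsLaw (linAction S₀ D ((k : ℕ) / (n : ℝ))))
      = ∑ k ∈ range n, klFin (gibbsLaw (linAction S₀ D (((k + 1 : ℕ) : ℝ) / n)))
          (gibbsLaw (linAction S₀ D ((k : ℝ) / n))) :=
    Fin.sum_univ_eq_sum_range (fun k => klFin (gibbsLaw (linAction S₀ D (((k + 1 : ℕ) : ℝ) / n)))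
      (gibbsLaw (linAction S₀ D ((k : ℝ) / n)))) n
  have hrev := (abs_le.mp (abs_sum_klFin_reverse_uniform_sub_floor_le S₀ D hn hM)).1
  refine h.trans ?_
  rw [Real.exp_le_exp, hsum]
  linarith

end Summit.Ventures.LatticeQCDFlow.Exactness
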